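import Summits.QuantumFields.YangMills.Theorems.BalabanUVNodesN07AveragedPlaquetteCornerBlocks
import Summits.QuantumFields.YangMills.Theorems.BalabanUVNodesN07Lemma1CrossingBondsAtRecord
import HarnessLib

/-!
# N07 [B11] (= [15] = [Balaban1985Variational]) Sect. F, (160) CASE II — [6] LEMMA 1 (1.25) FOR THE (0.4) AVERAGING OF RECORD WITH THE **TWO-BLOCK** HULL (cure of ⚑ LOCATED-THIRD-BLOCK,
# OUTWARD-MEET-EDITION-SPEC §10 addendum 2): the loop variables and the correction factor of (0.4) at a coarse bond `c` are small as soon as the plaquettes with all four corners in the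
# TWO blocks `B(c₋) ∪ B(c₊)` are small — so every far-face crossing bond is within `dist1 (Ū c) + 7t₂ + (d+1)(L−1)τ` of `1` under hypotheses on the two blocks ONLY

Cell `pub-ymgap`, seat `pub-ymgap-dag-n07-e` g24 (FAN-OUT §N07 row s3; LANE OWNER of the K0 road), MODULE 70.  `--kind proof --supports stmt-QuantumFields-20541 --as helper` (K0⁷);
count-neutral; def-free.  [6] = [Balaban1985RegularSpaces]; [15] = [Balaban1985Variational]; [I] = [Balaban1987RG1]; [3] = [Balaban1985Averaging].

WHY (SPEC §10 addendum 2, ⚑ LOCATED-THIRD-BLOCK).  Print's (160) case II applies [6] Lemma 1 on the TWO blocks `B(x) ∪ B(x′)` of a dent bond with the (k−1)-DATA's plaquettes.  The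
tree's Lemma-1 suppliers (dag-n07-w5 `N07Lemma1CrossingBondsAtRecord.dist1_crossingBond_le_avg_add`, `N07Lemma1CrossingFlat.dist1_openHol_le_of_plaqSmallOn_blocks`, dag-n07-w6
`N07DataDownTheTower.dist1_iter_le_of_succ`) ask the plaquette letter on THREE blocks `B(c₋ − e_μ) ∪ B(c₋) ∪ B(c₊)` (`blockOf q.src ∈ {c₋ − e_μ, c₋, c₊}`): the block BEHIND enters only
through the walk-hull Stokes bound `HistoryTailStokesLocal.dist1_loopHol_le_local` for the (0.4) loop variables, whose calculus rearranges the loop word.  For a dent bond whose block behind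
is a CORE block (under `Ω_j`) the level-`(j−1)` plaquettes there are NOT data — an ε-type letter would leak into the near rows.  THIS FILE removes the third block: the loop variables at `c` are
gauge-COVARIANT closed holonomies based at the centre of `B(c₋)` (`BlockAveraging.loopHol_gaugeAct`) and read only bonds with both ends in the two blocks (`T4ReflectionConeSharp.loopHol_congr₂`),
so MODULE 68's axial extension applies: in pv26's axial gauge `h` on the box `B(c₋) ∪ B(c₊)`, extended by `1`, every plaquette of the torus is small (MODULE 68
`dist1_plaqHol_extendOne_gaugeAct_axialGauge_le`), the GLOBAL Stokes bound `LatticeWordStokes.dist1_loopHol_le` bounds the extension's loop variables, and these equal the conjugates of `U`'s.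
The correction factor is the small-loop average of the loop variables (`BlockAveraging.corr`, guard `Small` now MET), hence `6t₂`-close to `1` (`dist1_expMeanLogSU_avg_le`); the rest of
Lemma 1 (straight transporter vs. average, the open transporters, the crossing bonds via rectangles inside the two blocks) is dag-n07-w5's, two-block already, BY NAME.

WHAT IS PROVED (sorry-free; no definition; axioms standard; generic `P : Params`, standing range `m + 1 ≤ P.m + P.K`, `SU(n)`; the box of the two blocks does not wrap: `2L < N_m`).
§1 `twoBlockBox_mem` (the sites of `B(c₋) ∪ B(c₊)` lie in the blow-down box `[L·x, L·(x + e_μ) + (L−1)]` of `c = ⟨castSite x, μ⟩`), ★★ `dist1_loopHol_le_of_twoBlocks` (every (0.4) loop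
variable `≤ t₂ := (((d+2)L)²∕4)·((4(d−1)(2L−1) + 1)·a)` from `PlaqSmallOn (boxPlaqs (L·x) (L·(x + e_μ) + (L−1))) a U`), ★ `small_of_twoBlocks`, ★★ `dist1_corr_le_of_twoBlocks` (`≤ 6t₂`),
`dist1_axialAvg_le_avgFun_add_of_twoBlocks`; §2 ★★ `dist1_openHol_le_of_twoBlocks` (`≤ dist1 (Ū c) + 7t₂`), ★★★ `dist1_crossingBond_le_avgFun_add_of_twoBlocks` (Lemma 1 (1.25): every far-face
crossing bond `≤ dist1 (Ū c) + 7t₂ + (d+1)(L−1)τ`, `Ū = avgFun expMeanLogSU U`), ★★★ `dist1_crossingBond_le_avOfRecord_add_of_twoBlocks` (the same at `Node00.avOfRecord F N K m`); §3 ★★★ `dist1_crossingBond_iter_le_of_succ_twoBlocks` (dag-n07-w6's one step of (155) down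
the tower, `N07RadialAxialTower.dist1_crossingBond_iter_le_of_succ`, with the two-block hull: the dent's near rows at the representative `U′`).

HONEST SCOPE.  Count-neutral lattice gauge algebra on ONE configuration; crude constant (`t₂` carries MODULE 68's factor `4(d−1)(2L−1) + 1`); the within-block letter `τ` and the coarse row
`dist1 (Ū c)` are HYPOTHESES (the consumer's radial ∕ block-wise gauge and MODULE 62's top rows); the DENT ROWS themselves ((C1b): which dent bonds, the radial representative of `NrmOfRecord`,
the (j−1)-data's plaquettes on the dent) are NOT assembled here; nothing of [15]∕[6]∕[3] analysis asserted beyond the cited bookkeeping; K0⁷ ∕ K1⁹ NOT closed; N07 NOT discharged; counts unmoved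
(typed 28∕28 · discharged 5∕27); one finite 𝕋⁴ programme at fixed ε — the route closes the conditional finite-𝕋⁴ rung `BalabanLadder.UV` ONLY; the YM mass gap (Clay) is NOT proved by any of
this; nothing continuum ∕ ℝ⁴ ∕ OS.  No `sorry`, no `def`, no `instance`, no `notation`.  RELATED, NOT DUPLICATED (BY NAME): dag-n07-w5 `…CrossingBonds.dist1_crossingBond_le_openHol_add`,
`…CrossingFlat.dist1_openHol_le_loopHol_add ∕ dist1_axialAvg_le_dist1_corr_add` (consumed), `…CrossingBondsAtRecord.dist1_crossingBond_le_avg_add` (the three-block edition, stands);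
`LatticeWordStokes.dist1_loopHol_le`, `BlockAveraging.loopHol_gaugeAct`, `T4ReflectionConeSharp.loopHol_congr₂`, `BlockAveragingPlaquetteBound.dist1_expMeanLogSU_avg_le`; MODULE 68.

References: [6] Lemma 1 (1.24)–(1.25) p. 79, p. 80 l. 1–4; [15] (160) p. 303 (case II); [I] (0.3)–(0.4) p. 253; [3] Prop. 1 p. 25 («a local result … on Δ(p′)»).
-/

set_option autoImplicit false

noncomputable section
open scoped BigOperators Matrix.Norms.L2Operator

namespace Summit.QuantumFields.YangMills.BalabanUVNodes.N07Lemma1CrossingBondsTwoBlocks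

open Literature.MathematicalPhysics.QuantumFieldTheory.Balaban1983to89
open Literature.MathematicalPhysics.QuantumFieldTheory.Balaban1983to89.Node00
open T4Continuum
open T4AxialGaugeSmallField (castSite castSite_apply castSite_add_e boxBonds boxPlaqs axialGauge dist1_gaugeAct_axialGauge_le_of_mem_boxBonds)
open B7Prop1Explicit (e e_apply)
open GaugeField (gaugeAct plaqHol)
open ExpMeanLog (expMeanLogSU deltaSU)
open BlockAveraging (avgFun loopHol corr Small Idx loopHol_gaugeAct blockAvg_avg)
open AveragingRT (axialAvg)
open BlockAveragingHaarAC (openHol)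
open Summit.QuantumFields.YangMills.BalabanUVNodes.N07ShearSizeTopBox (mem_boxBonds_of_ends_mem_box)
open Summit.QuantumFields.YangMills.BalabanUVNodes.N07AveragedPlaquetteCornerBlocks (mem_blowDown_of_blockOf_mem_box dist1_plaqHol_extendOne_gaugeAct_axialGauge_le)
open Summit.QuantumFields.YangMills.BalabanUVNodes.N07Lemma1CrossingFlat (dist1_openHol_le_loopHol_add dist1_axialAvg_le_dist1_corr_add)
open Summit.QuantumFields.YangMills.BalabanUVNodes.N07Lemma1CrossingBonds (dist1_crossingBond_le_openHol_add)

variable {P : Params} {m : ℕ}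

/-! ## §1  The loop variables and the correction factor of (0.4) from the plaquettes of the TWO blocks -/

section TwoBlocks

variable {n : Type*} [Fintype n] [DecidableEq n] [Nonempty n]

/-- The sites whose block is `c₋ = castSite x` or `c₊ = castSite (x + e_μ)` lie in the blow-down box `castSite '' [L·x, L·(x + e_μ) + (L − 1)]` (MODULE 68 `mem_blowDown_of_blockOf_mem_box` on
`[x, x + e_μ]`). [cite: Balaban1987RG1, (0.3) p.252 (bookkeeping)] -/
theorem twoBlockBox_mem (hm : m + 1 ≤ P.m + P.K) (x : Fin P.d → ℤ) (μ : Fin P.d) {y : Site P m}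
    (hy : blockOf y = (castSite x : Site P (m + 1)) ∨ blockOf y = (castSite x : Site P (m + 1)).shift μ) :
    y ∈ (castSite '' Set.Icc (fun i => (P.L : ℤ) * x i) (fun i => (P.L : ℤ) * (x + e μ) i + ((P.L : ℤ) - 1)) : Set (Site P m)) := by
  refine mem_blowDown_of_blockOf_mem_box hm ?_
  have h0 : ∀ κ, (0 : ℤ) ≤ e μ κ := fun κ => by rw [e_apply]; split_ifs <;> norm_num
  rcases hy with h | h
  · exact ⟨x, ⟨le_rfl, fun κ => by simp only [Pi.add_apply]; linarith [h0 κ]⟩, h.symm⟩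
  · exact ⟨x + e μ, ⟨fun κ => by simp only [Pi.add_apply]; linarith [h0 κ], le_rfl⟩, by rw [castSite_add_e]; exact h.symm⟩

open scoped Classical in
/-- ★★ **THE (0.4) LOOP VARIABLES FROM THE PLAQUETTES OF THE TWO BLOCKS** (standing range, `0 < a`, `2L < N_m`): if the level-`m` plaquettes based in the blow-down box of `B(c₋) ∪ B(c₊)`,
`c = ⟨castSite x, μ⟩`, are within `a` of `1`, then EVERY loop variable `U(Γ ∪ [y, y′] ∪ (−Γ′) ∪ (−c))` of (0.4) at `c` is within `t₂ := (((d+2)L)²∕4)·((4(d−1)(2L−1) + 1)·a)` of `1` — the loop is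
a closed holonomy based at the centre of `B(c₋)` (gauge covariant, `loopHol_gaugeAct`) reading only bonds with both ends in the two blocks (`loopHol_congr₂`), so it is conjugate to the loop variable
of MODULE 68's axial extension `U♭` (pv26's axial gauge on the box, `1` outside), which is globally plaquette-small; `LatticeWordStokes.dist1_loopHol_le`.
[cite: Balaban1987RG1, (0.4) p.253; Balaban1985RegularSpaces, Lemma 1 (1.25) p.79; Balaban1985Averaging, (19)–(20) p.21] -/
theorem dist1_loopHol_le_of_twoBlocks (hm : m + 1 ≤ P.m + P.K) {a : ℝ} (ha : 0 < a) (hN : 2 * P.L < P.sitesPerDir m)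
    (U : GaugeField P m (Matrix.specialUnitaryGroup n ℂ)) (x : Fin P.d → ℤ) (μ : Fin P.d)
    (hU : PlaqSmallOn (boxPlaqs (fun i => (P.L : ℤ) * x i) (fun i => (P.L : ℤ) * (x + e μ) i + ((P.L : ℤ) - 1))) a U) (i : Idx P) :
    dist1 (loopHol U ⟨castSite x, μ⟩ i) ≤ ((((P.d + 2) * P.L : ℕ) : ℝ) ^ 2 / 4) * ((4 * ((((P.d - 1 : ℕ) : ℝ)) * ((2 * P.L - 1 : ℕ) : ℝ)) + 1) * a) := by
  set lo : Fin P.d → ℤ := fun i => (P.L : ℤ) * x i with hlo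
  set hi : Fin P.d → ℤ := fun i => (P.L : ℤ) * (x + e μ) i + ((P.L : ℤ) - 1) with hhi
  set h : GaugeTransf P m (Matrix.specialUnitaryGroup n ℂ) := axialGauge U lo hi with hh
  set Uf : GaugeField P m (Matrix.specialUnitaryGroup n ℂ) := fun b => if b ∈ boxBonds lo hi then gaugeAct h U b else 1 with hUf
  set c : PBond P (m + 1) := ⟨castSite x, μ⟩ with hc
  -- the box has at most `2L` labels per direction
  have hn : ∀ κ, hi κ ≤ lo κ + ((2 * P.L - 1 : ℕ) : ℤ) := by
    intro κ
    have hcast : ((2 * P.L - 1 : ℕ) : ℤ) = 2 * (P.L : ℤ) - 1 := by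
      have : 1 ≤ 2 * P.L := by have := P.L_pos; omega
      push_cast [Nat.cast_sub this]; ring
    have h01 : (0 : ℤ) ≤ e μ κ ∧ e μ κ ≤ 1 := by rw [e_apply]; split_ifs <;> norm_num
    have hL1 : (1 : ℤ) ≤ P.L := by exact_mod_cast P.L_pos
    simp only [hhi, hlo, Pi.add_apply, hcast]
    nlinarith [h01.1, h01.2]
  have hnN : 2 * P.L - 1 < P.sitesPerDir m := by omega
  have hN' : ∀ κ, hi κ + 1 - lo κ < P.sitesPerDir m := by
    intro κ
    have := hn κ
    have h2 : ((2 * P.L - 1 : ℕ) : ℤ) + 1 + 1 ≤ (P.sitesPerDir m : ℤ) := by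
      have h1 : 1 ≤ 2 * P.L := by have := P.L_pos; omega
      push_cast [Nat.cast_sub h1]
      have : ((2 * P.L : ℕ) : ℤ) < (P.sitesPerDir m : ℤ) := by exact_mod_cast hN
      push_cast at this
      linarith
    linarith
  -- (i) the axial extension is globally plaquette-small
  have hflat : PlaqSmall ((4 * ((((P.d - 1 : ℕ) : ℝ)) * ((2 * P.L - 1 : ℕ) : ℝ)) + 1) * a) Uf := by
    intro q
    have hq := dist1_plaqHol_extendOne_gaugeAct_axialGauge_le U ha.le hU hn hnN q
    have : 4 * ((((P.d - 1 : ℕ) : ℝ)) * ((2 * P.L - 1 : ℕ) : ℝ) * a) < (4 * ((((P.d - 1 : ℕ) : ℝ)) * ((2 * P.L - 1 : ℕ) : ℝ)) + 1) * a := by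
      nlinarith
    exact lt_of_le_of_lt (by simpa [hUf] using hq) this
  -- (ii) the global Stokes bound for the extension's loop variable
  have hglob := LatticeWordStokes.dist1_loopHol_le (by positivity : (0 : ℝ) ≤ (4 * ((((P.d - 1 : ℕ) : ℝ)) * ((2 * P.L - 1 : ℕ) : ℝ)) + 1) * a)
    hflat c i
  -- (iii) two-block locality: the loop variables of `U♭` and of `U^h` at `c` agree
  have hloc : loopHol Uf c = loopHol (gaugeAct h U) c := by
    refine T4ReflectionConeSharp.loopHol_congr₂ hm Uf (gaugeAct h U) c fun b hbs hbt => ?_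
    have hs' : blockOf b.src = (castSite x : Site P (m + 1)) ∨ blockOf b.src = (castSite x : Site P (m + 1)).shift μ := hbs
    have ht' : blockOf b.tgt = (castSite x : Site P (m + 1)) ∨ blockOf b.tgt = (castSite x : Site P (m + 1)).shift μ := hbt
    have hmem : b ∈ boxBonds lo hi := mem_boxBonds_of_ends_mem_box hN' (twoBlockBox_mem hm x μ hs') (twoBlockBox_mem hm x μ ht')
    simp only [hUf, if_pos hmem]
  -- (iv) covariance of the closed loop: conjugation by `h` at the centre of `B(c₋)`
  have hcov : loopHol (gaugeAct h U) c i = h (emb c.src) * loopHol U c i * (h (emb c.src))⁻¹ := loopHol_gaugeAct h U c i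
  have hfin : dist1 (loopHol U c i) = dist1 (loopHol Uf c i) := by
    rw [congrFun hloc i, hcov, GaugeGroup.dist1_conj]
  rw [hfin]
  exact hglob

/-- ★ **THE GUARD OF (0.4) IS MET FROM THE TWO BLOCKS**: under §1's hypotheses and `t₂ < δ_n`, `Small expMeanLogSU U c` (every loop variable `< δ_n`), so `corr` IS the small-loop average.
[cite: Balaban1987RG1, (0.4)–(0.5) p.253] -/
theorem small_of_twoBlocks (hm : m + 1 ≤ P.m + P.K) {a : ℝ} (ha : 0 < a) (hN : 2 * P.L < P.sitesPerDir m)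
    (ht : ((((P.d + 2) * P.L : ℕ) : ℝ) ^ 2 / 4) * ((4 * ((((P.d - 1 : ℕ) : ℝ)) * ((2 * P.L - 1 : ℕ) : ℝ)) + 1) * a) < deltaSU n)
    (U : GaugeField P m (Matrix.specialUnitaryGroup n ℂ)) (x : Fin P.d → ℤ) (μ : Fin P.d)
    (hU : PlaqSmallOn (boxPlaqs (fun i => (P.L : ℤ) * x i) (fun i => (P.L : ℤ) * (x + e μ) i + ((P.L : ℤ) - 1))) a U) :
    Small (expMeanLogSU (n := n)) U ⟨castSite x, μ⟩ :=
  fun i => lt_of_le_of_lt (dist1_loopHol_le_of_twoBlocks hm ha hN U x μ hU i) ht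

/-- ★★ **THE CORRECTION FACTOR OF (0.4) FROM THE PLAQUETTES OF THE TWO BLOCKS**: `dist1 (corr expMeanLogSU U c) ≤ 6t₂` (the guard is met, §1; the average of a `t₂`-small family on `SU(n)`
is `6t₂`-close to `1`, `BlockAveragingPlaquetteBound.dist1_expMeanLogSU_avg_le`). [cite: Balaban1987RG1, (0.4) p.253; Balaban1985RegularSpaces, Lemma 1 (1.25) p.79] -/
theorem dist1_corr_le_of_twoBlocks (hm : m + 1 ≤ P.m + P.K) {a : ℝ} (ha : 0 < a) (hN : 2 * P.L < P.sitesPerDir m)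
    (ht : ((((P.d + 2) * P.L : ℕ) : ℝ) ^ 2 / 4) * ((4 * ((((P.d - 1 : ℕ) : ℝ)) * ((2 * P.L - 1 : ℕ) : ℝ)) + 1) * a) < deltaSU n)
    (U : GaugeField P m (Matrix.specialUnitaryGroup n ℂ)) (x : Fin P.d → ℤ) (μ : Fin P.d)
    (hU : PlaqSmallOn (boxPlaqs (fun i => (P.L : ℤ) * x i) (fun i => (P.L : ℤ) * (x + e μ) i + ((P.L : ℤ) - 1))) a U) :
    dist1 (corr (expMeanLogSU (n := n)) U ⟨castSite x, μ⟩) ≤ 6 * (((((P.d + 2) * P.L : ℕ) : ℝ) ^ 2 / 4) * ((4 * ((((P.d - 1 : ℕ) : ℝ)) * ((2 * P.L - 1 : ℕ) : ℝ)) + 1) * a)) := by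
  classical
  have hsmall := small_of_twoBlocks hm ha hN ht U x μ hU
  unfold BlockAveraging.corr
  rw [if_pos hsmall]
  exact BlockAveragingPlaquetteBound.dist1_expMeanLogSU_avg_le (fun i => dist1_loopHol_le_of_twoBlocks hm ha hN U x μ hU i) ht

/-- **THE STRAIGHT TRANSPORTER VS. THE AVERAGE, TWO BLOCKS**: `dist1 (U(Γ_c)) ≤ dist1 (Ū c) + 6t₂` (`Ū = corr · U(Γ_c)`, dag-n07-w5's `dist1_axialAvg_le_dist1_corr_add`).
[cite: Balaban1987RG1, (0.4) p.253] -/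
theorem dist1_axialAvg_le_avgFun_add_of_twoBlocks (hm : m + 1 ≤ P.m + P.K) {a : ℝ} (ha : 0 < a) (hN : 2 * P.L < P.sitesPerDir m)
    (ht : ((((P.d + 2) * P.L : ℕ) : ℝ) ^ 2 / 4) * ((4 * ((((P.d - 1 : ℕ) : ℝ)) * ((2 * P.L - 1 : ℕ) : ℝ)) + 1) * a) < deltaSU n)
    (U : GaugeField P m (Matrix.specialUnitaryGroup n ℂ)) (x : Fin P.d → ℤ) (μ : Fin P.d)
    (hU : PlaqSmallOn (boxPlaqs (fun i => (P.L : ℤ) * x i) (fun i => (P.L : ℤ) * (x + e μ) i + ((P.L : ℤ) - 1))) a U) :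
    dist1 (axialAvg U ⟨castSite x, μ⟩) ≤ dist1 (avgFun (expMeanLogSU (n := n)) U ⟨castSite x, μ⟩) +
      6 * (((((P.d + 2) * P.L : ℕ) : ℝ) ^ 2 / 4) * ((4 * ((((P.d - 1 : ℕ) : ℝ)) * ((2 * P.L - 1 : ℕ) : ℝ)) + 1) * a)) := by
  have h₁ := dist1_axialAvg_le_dist1_corr_add (expMeanLogSU (n := n)) U ⟨castSite x, μ⟩
  have h₂ := dist1_corr_le_of_twoBlocks hm ha hN ht U x μ hU
  linarith

end TwoBlocks

/-! ## §2  Lemma 1 (1.25) with the two-block hull: the open transporters and every far-face crossing bond -/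

section Lemma1

variable {n : Type*} [Fintype n] [DecidableEq n] [Nonempty n]

/-- ★★ **EVERY TRANSPORTER OF THE (0.4) FAMILY IS SMALL, TWO BLOCKS**: `dist1 (U(Γ ∪ [y, y′] ∪ (−Γ′))) ≤ dist1 (Ū c) + 7t₂` for every index — dag-n07-w5's `dist1_openHol_le_of_plaqSmallOn_blocks`
with the block behind `B(c₋ − e_μ)` REMOVED from the hypothesis. [cite: Balaban1987RG1, (0.4) p.253; Balaban1985RegularSpaces, Lemma 1 (1.25) p.79] -/
theorem dist1_openHol_le_of_twoBlocks (hm : m + 1 ≤ P.m + P.K) {a : ℝ} (ha : 0 < a) (hN : 2 * P.L < P.sitesPerDir m)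
    (ht : ((((P.d + 2) * P.L : ℕ) : ℝ) ^ 2 / 4) * ((4 * ((((P.d - 1 : ℕ) : ℝ)) * ((2 * P.L - 1 : ℕ) : ℝ)) + 1) * a) < deltaSU n)
    (U : GaugeField P m (Matrix.specialUnitaryGroup n ℂ)) (x : Fin P.d → ℤ) (μ : Fin P.d)
    (hU : PlaqSmallOn (boxPlaqs (fun i => (P.L : ℤ) * x i) (fun i => (P.L : ℤ) * (x + e μ) i + ((P.L : ℤ) - 1))) a U) (i : Idx P) :
    dist1 (openHol U ⟨castSite x, μ⟩ i) ≤ dist1 (avgFun (expMeanLogSU (n := n)) U ⟨castSite x, μ⟩) +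
      7 * (((((P.d + 2) * P.L : ℕ) : ℝ) ^ 2 / 4) * ((4 * ((((P.d - 1 : ℕ) : ℝ)) * ((2 * P.L - 1 : ℕ) : ℝ)) + 1) * a)) := by
  have h₁ := dist1_openHol_le_loopHol_add U ⟨castSite x, μ⟩ i
  have h₂ := dist1_loopHol_le_of_twoBlocks hm ha hN U x μ hU i
  have h₃ := dist1_axialAvg_le_avgFun_add_of_twoBlocks hm ha hN ht U x μ hU
  linarith

/-- ★★★ **[6] LEMMA 1 (1.25) FOR THE (0.4) AVERAGING, TWO-BLOCK HULL**: if the level-`m` plaquettes based in the blow-down box of `B(c₋) ∪ B(c₊)`, `c = ⟨castSite x, μ⟩`, are within `a` of `1`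
(`0 < a`, `2L < N_m`, `t₂ < δ_n`) and the bonds INSIDE `B(c₋)`, `B(c₊)` are `τ`-close to `1`, then every far-face crossing bond `⟨blockSite c₋ r, μ⟩` (`r_μ = L − 1`) satisfies
`dist1 ≤ dist1 (Ū c) + 7t₂ + (d+1)(L−1)·τ`, `Ū = avgFun expMeanLogSU U` — print's «|V′ − 1| < 4d²α₀ + α₁» with NO hypothesis on the block behind.
[cite: Balaban1985RegularSpaces, Lemma 1 (1.24)–(1.25) p.79, p.80 l.1–4; Balaban1985Variational, (160) p.303; Balaban1987RG1, (0.4) p.253] -/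
theorem dist1_crossingBond_le_avgFun_add_of_twoBlocks (hm : m + 1 ≤ P.m + P.K) {a : ℝ} (ha : 0 < a) (hN : 2 * P.L < P.sitesPerDir m)
    (ht : ((((P.d + 2) * P.L : ℕ) : ℝ) ^ 2 / 4) * ((4 * ((((P.d - 1 : ℕ) : ℝ)) * ((2 * P.L - 1 : ℕ) : ℝ)) + 1) * a) < deltaSU n)
    (U : GaugeField P m (Matrix.specialUnitaryGroup n ℂ)) (x : Fin P.d → ℤ) (μ : Fin P.d)
    (hU : PlaqSmallOn (boxPlaqs (fun i => (P.L : ℤ) * x i) (fun i => (P.L : ℤ) * (x + e μ) i + ((P.L : ℤ) - 1))) a U)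
    {τ : ℝ} (hτ : 0 ≤ τ)
    (hint : ∀ b : PBond P m, blockOf b.src = blockOf b.tgt →
      (blockOf b.src = (castSite x : Site P (m + 1)) ∨ blockOf b.src = (castSite x : Site P (m + 1)).shift μ) → dist1 (U b) ≤ τ)
    (r : Fin P.d → Fin P.L) (hr : (r μ : ℕ) = P.L - 1) (σ σ' : Equiv.Perm (Fin P.d)) :
    dist1 (U ⟨Site.blockSite (castSite x : Site P (m + 1)) r, μ⟩) ≤
      dist1 (avgFun (expMeanLogSU (n := n)) U ⟨castSite x, μ⟩) +
        7 * (((((P.d + 2) * P.L : ℕ) : ℝ) ^ 2 / 4) * ((4 * ((((P.d - 1 : ℕ) : ℝ)) * ((2 * P.L - 1 : ℕ) : ℝ)) + 1) * a)) +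
        (((P.d + 1) * (P.L - 1) : ℕ) : ℝ) * τ := by
  have h₁ := dist1_crossingBond_le_openHol_add hm U ⟨castSite x, μ⟩ r hr σ σ' hτ hint
  have h₂ := dist1_openHol_le_of_twoBlocks hm ha hN ht U x μ hU (r, σ, σ')
  linarith

/-- ★★★ **THE SAME AT THE AVERAGING OF RECORD** `Node00.avOfRecord F N K m` (`= blockAvg expMeanLogSU`): every far-face crossing bond of `M^m`-level data is within
`dist1 ((avOfRecord F N K m).avg U c) + 7t₂ + (d+1)(L−1)τ` of `1` under hypotheses on the TWO blocks only — the Lemma-1 step the DENT near rows of SPEC §10 (C1b) consume (`c` a dent bond's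
parent, the block behind may be a core block). [cite: Balaban1985RegularSpaces, Lemma 1 (1.25) p.79; Balaban1985Variational, (160) p.303; Balaban1987RG1, (0.4) p.253] -/
theorem dist1_crossingBond_le_avOfRecord_add_of_twoBlocks (F : T4Family) (N : ℕ) [NeZero N] (K : ℕ) {m : ℕ} (hm : m + 1 ≤ (F.P K).m + (F.P K).K)
    {a : ℝ} (ha : 0 < a) (hN : 2 * (F.P K).L < (F.P K).sitesPerDir m)
    (ht : (((((F.P K).d + 2) * (F.P K).L : ℕ) : ℝ) ^ 2 / 4) * ((4 * (((((F.P K).d - 1 : ℕ) : ℝ)) * ((2 * (F.P K).L - 1 : ℕ) : ℝ)) + 1) * a) < deltaSU (Fin N))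
    (U : GaugeField (F.P K) m (SU N)) (x : Fin (F.P K).d → ℤ) (μ : Fin (F.P K).d)
    (hU : PlaqSmallOn (boxPlaqs (fun i => ((F.P K).L : ℤ) * x i) (fun i => ((F.P K).L : ℤ) * (x + e μ) i + (((F.P K).L : ℤ) - 1))) a U)
    {τ : ℝ} (hτ : 0 ≤ τ)
    (hint : ∀ b : PBond (F.P K) m, blockOf b.src = blockOf b.tgt →
      (blockOf b.src = (castSite x : Site (F.P K) (m + 1)) ∨ blockOf b.src = (castSite x : Site (F.P K) (m + 1)).shift μ) → dist1 (U b) ≤ τ)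
    (r : Fin (F.P K).d → Fin (F.P K).L) (hr : (r μ : ℕ) = (F.P K).L - 1) (σ σ' : Equiv.Perm (Fin (F.P K).d)) :
    dist1 (U ⟨Site.blockSite (castSite x : Site (F.P K) (m + 1)) r, μ⟩) ≤
      dist1 ((avOfRecord F N K m).avg U ⟨castSite x, μ⟩) +
        7 * ((((((F.P K).d + 2) * (F.P K).L : ℕ) : ℝ) ^ 2 / 4) * ((4 * (((((F.P K).d - 1 : ℕ) : ℝ)) * ((2 * (F.P K).L - 1 : ℕ) : ℝ)) + 1) * a)) +
        ((((F.P K).d + 1) * ((F.P K).L - 1) : ℕ) : ℝ) * τ := by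
  rw [avOfRecord_apply, blockAvg_avg]
  exact dist1_crossingBond_le_avgFun_add_of_twoBlocks hm ha hN ht U x μ hU hτ hint r hr σ σ'

end Lemma1

/-! ## §3  One step of (155) down the tower, two blocks (dag-n07-w6's `dist1_crossingBond_iter_le_of_succ` without the block behind) -/

section Step

variable {F : T4Family} {N : ℕ} [NeZero N]

/-- ★★★ **ONE STEP OF (155) DOWN THE TOWER, TWO-BLOCK HULL** ([6] Lemma 1 (1.25) at `W := M^m(U′)`): for ANY `U′`, `m + 1 ≤ m_P + K`, a `(m+1)`-bond `c = ⟨castSite x, μ⟩` (`0 < a`, `2L < N_m`,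
the `δ_N`-guard): if the level-`m` plaquettes of `M^m U′` based in the blow-down box of `B(c₋) ∪ B(c₊)` are `< a`, the NEXT level's letter `dist1 (M^{m+1}U′(c)) ≤ α` and the within-block
letter `dist1 (M^m U′ b) ≤ τ` on the bonds inside `B(c₋)`, `B(c₊)`, then every far-face crossing bond obeys `dist1 (M^m U′ ⟨blockSite c₋ r, μ⟩) ≤ α + 7t₂ + (d+1)(L−1)·τ` — dag-n07-w6's
`N07RadialAxialTower.dist1_crossingBond_iter_le_of_succ` with NO hypothesis on `B(c₋ − e_μ)` (the DENT's near rows at a representative `U′ = U″` whose block behind may be a core block).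
[cite: Balaban1985RegularSpaces, Lemma 1 (1.25) p.79; Balaban1985Variational, (155) p.302, (160) p.303; Balaban1987RG1, (0.4) p.253] -/
theorem dist1_crossingBond_iter_le_of_succ_twoBlocks {K m : ℕ} (hm : m + 1 ≤ (F.P K).m + (F.P K).K) (U' : GaugeField (F.P K) 0 (SU N)) {a α τ : ℝ}
    (ha : 0 < a) (hτ : 0 ≤ τ) (hN : 2 * (F.P K).L < (F.P K).sitesPerDir m)
    (ht : (((((F.P K).d + 2) * (F.P K).L : ℕ) : ℝ) ^ 2 / 4) * ((4 * (((((F.P K).d - 1 : ℕ) : ℝ)) * ((2 * (F.P K).L - 1 : ℕ) : ℝ)) + 1) * a) < deltaSU (Fin N))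
    (x : Fin (F.P K).d → ℤ) (μ : Fin (F.P K).d)
    (hW : PlaqSmallOn (boxPlaqs (fun i => ((F.P K).L : ℤ) * x i) (fun i => ((F.P K).L : ℤ) * (x + e μ) i + (((F.P K).L : ℤ) - 1))) a
      (Averaging.iter (avOfRecord F N K) m U'))
    (hα : dist1 (Averaging.iter (avOfRecord F N K) (m + 1) U' ⟨castSite x, μ⟩) ≤ α)
    (hint : ∀ b : PBond (F.P K) m, blockOf b.src = blockOf b.tgt →
      (blockOf b.src = (castSite x : Site (F.P K) (m + 1)) ∨ blockOf b.src = (castSite x : Site (F.P K) (m + 1)).shift μ) →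
      dist1 (Averaging.iter (avOfRecord F N K) m U' b) ≤ τ)
    (r : Fin (F.P K).d → Fin (F.P K).L) (hr : (r μ : ℕ) = (F.P K).L - 1) (σ σ' : Equiv.Perm (Fin (F.P K).d)) :
    dist1 (Averaging.iter (avOfRecord F N K) m U' ⟨Site.blockSite (castSite x : Site (F.P K) (m + 1)) r, μ⟩) ≤
      α + 7 * ((((((F.P K).d + 2) * (F.P K).L : ℕ) : ℝ) ^ 2 / 4) * ((4 * (((((F.P K).d - 1 : ℕ) : ℝ)) * ((2 * (F.P K).L - 1 : ℕ) : ℝ)) + 1) * a)) +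
        ((((F.P K).d + 1) * ((F.P K).L - 1) : ℕ) : ℝ) * τ := by
  have h := dist1_crossingBond_le_avOfRecord_add_of_twoBlocks F N K hm ha hN ht (Averaging.iter (avOfRecord F N K) m U') x μ hW hτ hint r hr σ σ'
  have hstep : (avOfRecord F N K m).avg (Averaging.iter (avOfRecord F N K) m U') ⟨castSite x, μ⟩ = Averaging.iter (avOfRecord F N K) (m + 1) U' ⟨castSite x, μ⟩ := rfl
  rw [hstep] at h
  linarith

end Step

end Summit.QuantumFields.YangMills.BalabanUVNodes.N07Lemma1CrossingBondsTwoBlocks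

end
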